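import Mathlib
import Summits.Ventures.PercRepro2.Defs
import Summits.Ventures.PercRepro2.Independence
import Summits.Ventures.PercRepro2.Harris
import Summits.Ventures.PercRepro2.Graph
import Summits.Ventures.PercRepro2.Events
import Summits.Ventures.PercRepro2.Induced
import Summits.Ventures.PercRepro2.BHKAvoid
import Summits.Ventures.PercRepro2.ZCPendantSecondOrder
import Summits.Ventures.PercRepro2.ZCMain

/-!
# Row 2′ZC, quantitative corollaries (blind cell PercRepro2, mine-a g30; MINE-A.md §85.7)

From the identity `zc_main_identity` and the nonnegativity of the cross-cluster slack:

* `zc_main_ge_cov`: `Z ≥ P(D)·Cov(U, γ) + P(B)·Cov(U, L ∪ γ)` — the (ZC) expression dominates the two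
  Harris covariances (each `≥ 0`), so in particular `Z ≥ P(D)·Cov(U, {a₃ ↔ o})`;
* `zc_main_ratio`: the ratio form `Cov(U, e ∩ L) ≥ ρ·Cov(U, e ∩ Lᶜ)` with `ρ = P(B)/P(D)` whenever
  `P(D) > 0` (the row's statement of record, `Cov(U, 1[a₃ ∈ C₁] 1[o ∈ C₁]) ≥ ρ·Cov(U, 1[a₃ ∈ C₁]·1[o ∉ C₁])`).
No definition; one seat.
-/

namespace Summit.Ventures.PercRepro2

namespace ZCMain

variable {V : Type*} {E : Type*} [Fintype E] [DecidableEq E] [Fintype V] [DecidableEq V]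
  {R : Type*} [Field R] [LinearOrder R] [IsStrictOrderedRing R]

/-- **Quantitative (ZC)**: the (ZC) expression dominates `P(D)·Cov(U, γ) + P(B)·Cov(U, L ∪ γ)`. -/
theorem zc_main_ge_cov (p : E → R) (hp : IsProbVec p) (ends : E → Sym2 V) (a₁ a₃ o : V)
    {𝓔 : Set (Set V)} (h𝓔 : IsUpperSet 𝓔) :
    let e := connEvent ends a₁ a₃
    let L := connEvent ends a₁ o
    let γ := connEvent ends a₃ o
    let U := clusterInEvent ends a₁ 𝓔
    prob p (eᶜ ∩ Lᶜ ∩ γᶜ) * (prob p (U ∩ γ) - prob p U * prob p γ) +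
        prob p (eᶜ ∩ Lᶜ ∩ γ) * (prob p (U ∩ (L ∪ γ)) - prob p U * prob p (L ∪ γ)) ≤
      prob p (eᶜ ∩ Lᶜ ∩ γᶜ) * (prob p (U ∩ (e ∩ L)) - prob p U * prob p (e ∩ L)) -
        prob p (eᶜ ∩ Lᶜ ∩ γ) * (prob p (U ∩ (e ∩ Lᶜ)) - prob p U * prob p (e ∩ Lᶜ)) := by
  intro e L γ U
  have t3 : 0 ≤ prob p (U ∩ (eᶜ ∩ Lᶜ)) * prob p (eᶜ ∩ Lᶜ ∩ γ) -
      prob p (U ∩ γ ∩ (eᶜ ∩ Lᶜ)) * prob p (eᶜ ∩ Lᶜ) := by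
    have := bhk_cross_cluster_avoid p hp ends a₁ a₃ (X := {a₃, o})
      (by simp) h𝓔 (ZCPendant.isUpperSet_mem_o (V := V) o)
    rw [ZCPendant.clusterInEvent_mem_o_eq, avoidAll_pair_eq] at this
    have s2 : γ ∩ (eᶜ ∩ Lᶜ) = eᶜ ∩ Lᶜ ∩ γ := Set.inter_comm _ _
    rw [s2] at this
    linarith
  rw [zc_main_identity p ends a₁ a₃ o 𝓔]
  linarith

/-- **The ratio form of row 2′ZC**: when `P(D) > 0`,
`Cov(U, e ∩ L) ≥ (P(B)/P(D))·Cov(U, e ∩ Lᶜ)`. -/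
theorem zc_main_ratio (p : E → R) (hp : IsProbVec p) (ends : E → Sym2 V) (a₁ a₃ o : V)
    {𝓔 : Set (Set V)} (h𝓔 : IsUpperSet 𝓔) :
    let e := connEvent ends a₁ a₃
    let L := connEvent ends a₁ o
    let γ := connEvent ends a₃ o
    let U := clusterInEvent ends a₁ 𝓔
    0 < prob p (eᶜ ∩ Lᶜ ∩ γᶜ) →
      prob p (eᶜ ∩ Lᶜ ∩ γ) / prob p (eᶜ ∩ Lᶜ ∩ γᶜ) *
          (prob p (U ∩ (e ∩ Lᶜ)) - prob p U * prob p (e ∩ Lᶜ)) ≤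
        prob p (U ∩ (e ∩ L)) - prob p U * prob p (e ∩ L) := by
  intro e L γ U hD
  have h := zc_main p hp ends a₁ a₃ o h𝓔
  simp only at h
  rw [div_mul_eq_mul_div, div_le_iff₀ hD]
  linarith

end ZCMain

end Summit.Ventures.PercRepro2
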